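import Literature.Analysis.FluidPDE.CaloricKernelFamilies
import Literature.Analysis.FluidPDE.NewtonTestPotential
import HarnessLib

/-!
# Backward caloric Duhamel integrals as space–time potentials: the kernel representations

Analysis/FluidPDE support file for the discharge of the named fact
`Literature.Analysis.FluidPDE.NSBoundedInteriorContinuity` (`NSBoundedInteriorRegularity.lean`;
Seregin–Šverák 2009, §2). The duality proof tests the Navier–Stokes system with cut-offs of
the backward caloric Duhamel integrals (`heatDuhamelBack 1`, `HeatDuhamelBack.lean`)
`η = 𝒰[g]` and `Ξ = 𝒰[∂_c N[g]]` of a scalar space–time test function `g` (`N[h] = Γ₀ ⋆ h` the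
truncated Newtonian potential of `NewtonLocalPotential.lean`), and needs every derivative of these
fields that appears to be a **space–time convolution of `uncurry g` with an explicit backward
kernel** (`CaloricBackwardKernels.backKernel`). This file proves:

* `heatDuhamelBack_one_eq_convolution_backKernel` — the abstract mechanism: if the slices satisfy
  `e^{σΔ}(Θ(s + σ))(x) = ∫ κ σ y · g (s + σ) (x - y) dy` and the resulting double integral at
  `(s, x)` converges absolutely, then `𝒰[Θ](s)(x) = (backKernel κ ⋆ uncurry g)(s, x)` (Fubini and
  the substitution `σ = -τ`, as in `HeatDuhamelSmooth.heatDuhamelBack_eq_convolution`);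
* the slice identities: `heatD1 σ c (ρ ⋆ h) = (heatD1 σ c ρ) ⋆ h` for `ρ ∈ L¹` and continuous
  compactly supported `h` (associativity of convolution), and its consequences
  `e^{σΔ}(∂_c(ρ ⋆ h)) = (heatD1 σ c ρ) ⋆ h`, `e^{σΔ}(∂ᵥ∂_c(ρ ⋆ h)) = (heatD2 σ v c ρ) ⋆ h`,
  `e^{σΔ}(∂ᵤ∂ᵥ∂_c(ρ ⋆ h)) = (heatD3 σ u v c ρ) ⋆ h` for compactly supported `ρ ∈ L¹` and
  `h ∈ C_c^∞` (derivatives commute with the heat flow of smooth compactly supported data);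
* the space–time test field `(t, x) ↦ (ρ ⋆ g t)(x)` of a compactly supported `ρ ∈ L¹`
  (`isSpaceTimeTestOn_convolution_slices`);
* the representations (dimension three, `Γ₀ = newtonNear r₀ r₁`, `λ = newtonFarLaplacian r₀ r₁`):
  `η = backKernel G ⋆ g̃`, `∂ᵥη = backKernel (∂ᵥG) ⋆ g̃`, `Ξ = backKernel (heatD1 · c Γ₀) ⋆ g̃`,
  `∂ᵥΞ = backKernel (heatD2 · v c Γ₀) ⋆ g̃` at points spatially separated from the support of `g`,
  `∂ᵤ∂ᵥΞ = backKernel (heatD3 · u v c Γ₀) ⋆ g̃` (unit vectors), and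
  `𝒰[Λ[∂_c g]] = backKernel (heatD1 · c λ) ⋆ g̃`;
* the two PDE identities consumed by the duality argument: the backward heat equation
  `∂ₛη + Δη = -g` and `ΔΞ = ∂_cη - 𝒰[Λ[∂_c g]]` (from `ΔN[h] = h - Λ[h]`,
  `NewtonLocalPotential.laplacian_newtonNearPotential`).
-/

noncomputable section

open MeasureTheory Set Function Filter Metric Real ContinuousLinearMap TopologicalSpace
open scoped ENNReal NNReal Topology RealInnerProductSpace Convolution Laplacian

namespace Literature.Analysis.FluidPDE

section General

variable {E : Type*} [NormedAddCommGroup E] [InnerProductSpace ℝ E] [FiniteDimensional ℝ E]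
  [MeasurableSpace E] [BorelSpace E]

/-! ### The abstract representation lemma -/

/-- **Backward Duhamel integrals are space–time potentials.** If for every `σ > 0` the slice
identity `e^{σΔ}(Θ(s + σ))(x) = ∫ κ σ y · g(s + σ)(x - y) dy` holds at `x`, and the space–time
integrand `backKernel κ (q) · g(s - q.1)(x - q.2)` is integrable, then
`heatDuhamelBack 1 Θ s x = (backKernel κ ⋆ uncurry g)(s, x)` (Fubini; the substitution
`σ = -τ`). [folklore] -/
theorem heatDuhamelBack_one_eq_convolution_backKernel {Θ g : ℝ → E → ℝ} {κ : ℝ → E → ℝ}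
    (s : ℝ) (x : E)
    (hslice : ∀ σ : ℝ, 0 < σ →
      UnboundedOperators.heatExtension (Θ (s + σ)) σ x = ∫ y, κ σ y * g (s + σ) (x - y))
    (hint : Integrable (fun q : ℝ × E => backKernel κ q * g (s - q.1) (x - q.2))
      (volume : Measure (ℝ × E))) :
    heatDuhamelBack 1 Θ s x =
      (backKernel κ ⋆[lsmul ℝ ℝ, (volume : Measure (ℝ × E))] uncurry g) (s, x) := by
  rw [convolution_def]
  have hF : (fun q : ℝ × E => (lsmul ℝ ℝ) (backKernel κ q) (uncurry g ((s, x) - q))) =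
      fun q : ℝ × E => backKernel κ q * g (s - q.1) (x - q.2) := by
    funext q; rfl
  rw [hF, Measure.volume_eq_prod, integral_prod _ (by rwa [← Measure.volume_eq_prod])]
  have hsl : ∀ τ : ℝ, (∫ y : E, (fun q : ℝ × E => backKernel κ q * g (s - q.1) (x - q.2)) (τ, y)) =
      if τ < 0 then ∫ y, κ (-τ) y * g (s - τ) (x - y) else 0 := by
    intro τ
    by_cases hτ : τ < 0
    · simp only [backKernel_of_neg κ hτ, hτ, if_true]
    · simp only [backKernel_of_nonneg κ (not_lt.1 hτ), hτ, if_false, zero_mul, integral_zero]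
  simp_rw [hsl]
  have hind : (fun τ : ℝ => if τ < 0 then ∫ y, κ (-τ) y * g (s - τ) (x - y) else 0) =
      (Iio (0 : ℝ)).indicator fun τ => ∫ y, κ (-τ) y * g (s - τ) (x - y) := by
    funext τ; simp only [Set.indicator_apply, mem_Iio]
  rw [hind, integral_indicator measurableSet_Iio, ← integral_Iic_eq_integral_Iio,
    heatDuhamelBack_apply]
  have h := integral_comp_neg_Ioi 0 (fun τ => ∫ y, κ (-τ) y * g (s - τ) (x - y))
  simp only [neg_zero, neg_neg, sub_neg_eq_add] at h
  rw [← h]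
  refine setIntegral_congr_fun measurableSet_Ioi fun σ hσ => ?_
  rw [one_mul, hslice σ hσ]

/-- **Absolute convergence for slice-bound kernels**: the space–time integrand of
`heatDuhamelBack_one_eq_convolution_backKernel` is integrable for a slice-bound backward kernel
and a space–time test function. [folklore] -/
theorem IsSliceBoundKernel.integrable_backKernel_mul_test {κ : ℝ → E → ℝ} {N : ℝ → ℝ}
    (hK : IsSliceBoundKernel (backKernel κ) N) {g : ℝ → E → ℝ}
    (hg : IsSpaceTimeTestOn (⊤ : Opens (ℝ × E)) g) (s : ℝ) (x : E) :
    Integrable (fun q : ℝ × E => backKernel κ q * g (s - q.1) (x - q.2)) (volume : Measure (ℝ × E)) := by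
  haveI := isAddLeftInvariant_volume_real_prod (E := E)
  haveI := isNegInvariant_volume_real_prod (E := E)
  obtain ⟨M, hM0, hM⟩ := hg.exists_norm_le
  obtain ⟨a, b, hab⟩ := hg.exists_time_support
  have hgi : Integrable (uncurry g) (volume : Measure (ℝ × E)) :=
    hg.contDiff.continuous.integrable_of_hasCompactSupport hg.hasCompactSupport
  have h := integrable_kernel_mul_of_sliceBound (f := uncurry g) hK.measurable hK.slice_le hK.nonneg
    hK.locallyIntegrable hgi.aestronglyMeasurable (M := M)
    (Eventually.of_forall fun z => by rw [← Real.norm_eq_abs]; exact hM z.1 z.2)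
    (Eventually.of_forall fun z hz => by
      by_contra h
      exact hz (by have := hab z.1 h; simp only [uncurry]; rw [this]; rfl)) (s, x)
  -- change variables `q = (s, x) - w`
  have hmp : MeasurePreserving (fun q : ℝ × E => (s, x) - q) (volume : Measure (ℝ × E)) volume :=
    Measure.measurePreserving_sub_left volume (s, x)
  have heq : (fun q : ℝ × E => backKernel κ q * g (s - q.1) (x - q.2)) =
      (fun w : ℝ × E => backKernel κ ((s, x) - w) * uncurry g w) ∘ fun q : ℝ × E => (s, x) - q := by
    funext q
    simp only [Function.comp, sub_sub_cancel, uncurry, Prod.fst_sub, Prod.snd_sub]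
  rw [heq]
  exact (hmp.integrable_comp_emb (Homeomorph.subLeft ((s, x) : ℝ × E)).measurableEmbedding).2 h

/-- **Absolute convergence off the diagonal**: if the backward kernel is bounded on `ℝ × D`
and `x - y ∈ D` for every `y` in the spatial support of `g`, the space–time integrand is
integrable at `(s, x)`. [folklore] -/
theorem IsOffDiagKernel.integrable_backKernel_mul_test {κ : ℝ → E → ℝ} {D : Set E}
    (hK : IsOffDiagKernel (backKernel κ) D) {g : ℝ → E → ℝ}
    (hg : IsSpaceTimeTestOn (⊤ : Opens (ℝ × E)) g) {A : Set E} (hA : ∀ t y, g t y ≠ 0 → y ∈ A)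
    (s : ℝ) (x : E) (hx : ∀ a ∈ A, x - a ∈ D) :
    Integrable (fun q : ℝ × E => backKernel κ q * g (s - q.1) (x - q.2)) (volume : Measure (ℝ × E)) := by
  haveI := isAddLeftInvariant_volume_real_prod (E := E)
  haveI := isNegInvariant_volume_real_prod (E := E)
  obtain ⟨B, hB⟩ := hK.bdd
  have hgi : Integrable (uncurry g) (volume : Measure (ℝ × E)) :=
    hg.contDiff.continuous.integrable_of_hasCompactSupport hg.hasCompactSupport
  have hgi' : Integrable (fun q : ℝ × E => uncurry g ((s, x) - q)) (volume : Measure (ℝ × E)) :=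
    hgi.comp_sub_left (s, x)
  have hm : AEStronglyMeasurable (fun q : ℝ × E => backKernel κ q * g (s - q.1) (x - q.2))
      (volume : Measure (ℝ × E)) :=
    hK.measurable.aestronglyMeasurable.mul hgi'.aestronglyMeasurable
  refine (hgi'.norm.const_mul |B|).mono' hm (Eventually.of_forall fun q => ?_)
  rw [norm_mul]
  by_cases hq : g (s - q.1) (x - q.2) = 0
  · simp [hq, uncurry]
  · have hmem : x - (x - q.2) ∈ D := hx _ (hA _ _ hq)
    rw [sub_sub_cancel] at hmem
    have hKq : |backKernel κ q| ≤ |B| :=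
      ((hB q.1 q.2 hmem).trans (le_abs_self B))
    calc ‖backKernel κ q‖ * ‖g (s - q.1) (x - q.2)‖ ≤ |B| * ‖g (s - q.1) (x - q.2)‖ := by
          rw [Real.norm_eq_abs]; exact mul_le_mul_of_nonneg_right hKq (norm_nonneg _)
      _ = |B| * ‖uncurry g ((s, x) - q)‖ := rfl

/-! ### `η = 𝒰[g]` and its gradient -/

/-- **`𝒰[g]` is the heat potential of `g`**: `heatDuhamelBack 1 g s x = (backKernel G ⋆ g̃)(s, x)`
(the tree's `heatDuhamelBack_eq_convolution` with `heatDuhamelKernel 1 = backKernel G`).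
[folklore] -/
theorem heatDuhamelBack_one_eq_convolution_heatKernel {g : ℝ → E → ℝ}
    (hg : IsSpaceTimeTestOn (⊤ : Opens (ℝ × E)) g) (s : ℝ) (x : E) :
    heatDuhamelBack 1 g s x =
      (backKernel (UnboundedOperators.heatKernel (E := E)) ⋆[lsmul ℝ ℝ, (volume : Measure (ℝ × E))]
        uncurry g) (s, x) := by
  rw [hg.heatDuhamelBack_eq_convolution one_pos s x, heatDuhamelKernel_one_eq_backKernel]

/-- The slice identity for the gradient: `e^{σΔ}(∂ᵥh)(x) = ∫ ∂ᵥG_σ(y) h(x - y) dy` for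
`h ∈ C_c^∞`. [folklore] -/
theorem heatExtension_fderiv_apply_eq_integral_heatKernelGrad {h : E → ℝ}
    (hh : ContDiff ℝ ((⊤ : ℕ∞) : WithTop ℕ∞) h) (hhc : HasCompactSupport h) {σ : ℝ} (hσ : 0 < σ)
    (v x : E) :
    UnboundedOperators.heatExtension (fun y => fderiv ℝ h y v) σ x = ∫ y, heatKernelGrad v σ y * h (x - y) := by
  have m0 : MemLp h 1 (volume : Measure E) := hh.continuous.memLp_of_hasCompactSupport hhc
  obtain ⟨hh₁, hh₁c⟩ := contDiff_hasCompactSupport_fderiv_apply hh hhc v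
  have m1 : MemLp (fun y => fderiv ℝ h y v) 1 (volume : Measure E) :=
    hh₁.continuous.memLp_of_hasCompactSupport hh₁c
  rw [← UnboundedOperators.fderiv_heatExtension_apply_eq_heatExtension_fderiv
    (hh.of_le (by exact_mod_cast le_top)) m0 le_rfl m1 le_rfl hσ x]
  change heatD1 σ v h x = _
  rw [heatD1_eq_integral m0 le_rfl hσ v x]
  rfl

/-- **The gradient of `𝒰[g]` is the potential of `g` against the backward heat-gradient kernel**:
`∂ᵥ(𝒰[g](s))(x) = (backKernel (∂ᵥG) ⋆ g̃)(s, x)`. [folklore] -/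
theorem fderiv_heatDuhamelBack_one_eq_convolution_heatKernelGrad {g : ℝ → E → ℝ}
    (hg : IsSpaceTimeTestOn (⊤ : Opens (ℝ × E)) g) (s : ℝ) (x v : E) :
    fderiv ℝ (heatDuhamelBack 1 g s) x v =
      (backKernel (heatKernelGrad v) ⋆[lsmul ℝ ℝ, (volume : Measure (ℝ × E))] uncurry g) (s, x) := by
  rw [hg.fderiv_heatDuhamelBack_apply one_pos s x v]
  refine heatDuhamelBack_one_eq_convolution_backKernel s x (fun σ hσ => ?_)
    ((isSliceBoundKernel_backKernel_heatKernelGrad v).integrable_backKernel_mul_test hg s x)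
  exact heatExtension_fderiv_apply_eq_integral_heatKernelGrad (hg.contDiff_slice (s + σ))
    (hg.hasCompactSupport_slice (s + σ)) hσ v x

/-! ### The slice identities for convolutions with an `L¹` kernel -/

section Slice

variable {ρ : E → ℝ} {h : E → ℝ}

/-- The convolution of a locally integrable kernel with a smooth compactly supported function is
smooth. [folklore] -/
theorem contDiff_convolution_of_hasCompactSupport (hρ : LocallyIntegrable ρ volume)
    (hh : ContDiff ℝ ((⊤ : ℕ∞) : WithTop ℕ∞) h) (hhc : HasCompactSupport h) :
    ContDiff ℝ ((⊤ : ℕ∞) : WithTop ℕ∞) (ρ ⋆[lsmul ℝ ℝ, (volume : Measure E)] h) :=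
  hhc.contDiff_convolution_right (lsmul ℝ ℝ) hρ hh

/-- `‖ρ‖ ⋆ ‖h‖` is bounded by `sup ‖h‖ · ‖ρ‖₁` and measurable, hence in `L^∞`, for `ρ ∈ L¹` and
bounded measurable `h`. [folklore] -/
theorem memLp_top_norm_convolution_norm (hρ : Integrable ρ volume) (hhm : AEStronglyMeasurable h volume)
    {M : ℝ} (hM : ∀ x, ‖h x‖ ≤ M) :
    MemLp ((fun x => ‖ρ x‖) ⋆[mul ℝ ℝ, (volume : Measure E)] fun x => ‖h x‖) ∞ volume := by
  have hM0 : 0 ≤ M := (norm_nonneg _).trans (hM 0)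
  have hmeas : AEStronglyMeasurable ((fun x => ‖ρ x‖) ⋆[mul ℝ ℝ, (volume : Measure E)] fun x => ‖h x‖)
      volume :=
    (hρ.norm.aestronglyMeasurable.convolution_integrand (mul ℝ ℝ) hhm.norm).integral_prod_right'
  refine memLp_top_of_bound hmeas (M * ∫ x, ‖ρ x‖) (Eventually.of_forall fun x => ?_)
  rw [convolution_def, Real.norm_eq_abs]
  have hint : Integrable (fun t => ‖ρ t‖ * M) volume := hρ.norm.mul_const M
  calc |∫ t, mul ℝ ℝ ‖ρ t‖ ‖h (x - t)‖| = |∫ t, ‖ρ t‖ * ‖h (x - t)‖| := rfl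
    _ ≤ ∫ t, ‖ρ t‖ * M := by
        rw [abs_of_nonneg (integral_nonneg fun t => mul_nonneg (norm_nonneg _) (norm_nonneg _))]
        refine integral_mono_of_nonneg (Eventually.of_forall fun t =>
          mul_nonneg (norm_nonneg _) (norm_nonneg _)) hint (Eventually.of_forall fun t => ?_)
        exact mul_le_mul_of_nonneg_left (hM _) (norm_nonneg _)
    _ = M * ∫ x, ‖ρ x‖ := by rw [integral_mul_const, mul_comm]

/-- **The layer `heatD1 σ c` commutes with convolution by a bounded compactly supported
function**: `heatD1 σ c (ρ ⋆ h) = (heatD1 σ c ρ) ⋆ h` for `ρ ∈ L¹` and `h` continuous with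
compact support (associativity of convolution: both sides are `∂_cG_σ ⋆ ρ ⋆ h`). [folklore] -/
theorem heatD1_convolution_eq (hρ : Integrable ρ volume) (hh : Continuous h)
    (hhc : HasCompactSupport h) {σ : ℝ} (hσ : 0 < σ) (c : E) :
    heatD1 σ c (ρ ⋆[lsmul ℝ ℝ, (volume : Measure E)] h) =
      heatD1 σ c ρ ⋆[lsmul ℝ ℝ, (volume : Measure E)] h := by
  set G : E → ℝ := fun z => fderiv ℝ (UnboundedOperators.heatKernel (E := E) σ) z c with hG
  have hGi : Integrable G volume := UnboundedOperators.integrable_fderiv_heatKernel_apply hσ c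
  have hGtop : MemLp G ∞ volume := UnboundedOperators.memLp_fderiv_heatKernel_apply hσ c ∞
  have hρ1 : MemLp ρ 1 volume := (memLp_one_iff_integrable).2 hρ
  have hh1 : MemLp h 1 (volume : Measure E) := hh.memLp_of_hasCompactSupport hhc
  have hρh1 : MemLp (ρ ⋆[lsmul ℝ ℝ, (volume : Measure E)] h) 1 volume :=
    UnboundedOperators.memLp_convolution_lsmul hρ hh1 le_rfl
  obtain ⟨M, hM⟩ := hhc.exists_bound_of_continuous hh
  -- both sides are `G ⋆ ρ ⋆ h`
  rw [heatD1_eq_convolution hρh1 le_rfl hσ c, heatD1_eq_convolution hρ1 le_rfl hσ c]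
  funext x
  haveI : (∞ : ℝ≥0∞).HolderConjugate 1 := ENNReal.HolderConjugate.top_one
  haveI : (1 : ℝ≥0∞).HolderConjugate ∞ := ENNReal.HolderConjugate.one_top
  symm
  refine convolution_assoc (L := lsmul ℝ ℝ) (L₂ := lsmul ℝ ℝ) (L₃ := lsmul ℝ ℝ) (L₄ := lsmul ℝ ℝ)
    (fun a b d => by simp only [lsmul_apply, smul_eq_mul, mul_assoc]) ?_ ?_ ?_ ?_ ?_ ?_
  · exact hGi.aestronglyMeasurable
  · exact hρ.aestronglyMeasurable
  · exact hh.aestronglyMeasurable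
  · exact Eventually.of_forall fun y =>
      UnboundedOperators.convolutionExistsAt_of_memLp (lsmul ℝ ℝ) hGtop hρ1 y
  · refine Eventually.of_forall fun y => ?_
    exact UnboundedOperators.convolutionExistsAt_of_memLp (mul ℝ ℝ)
      ((memLp_one_iff_integrable).2 hρ.norm)
      (memLp_top_of_bound hh.norm.aestronglyMeasurable M (Eventually.of_forall fun z => by
        rw [norm_norm]; exact hM z)) y
  · exact UnboundedOperators.convolutionExistsAt_of_memLp (mul ℝ ℝ)
      ((memLp_one_iff_integrable).2 hGi.norm)
      (memLp_top_norm_convolution_norm hρ hh.aestronglyMeasurable hM) x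

variable (hρ : Integrable ρ volume) (hρc : HasCompactSupport ρ)
  (hh : ContDiff ℝ ((⊤ : ℕ∞) : WithTop ℕ∞) h) (hhc : HasCompactSupport h)

include hρ hρc hh hhc

/-- For compactly supported `ρ ∈ L¹` and `h ∈ C_c^∞`, `ρ ⋆ h ∈ C_c^∞`. [folklore] -/
theorem contDiff_hasCompactSupport_convolution :
    ContDiff ℝ ((⊤ : ℕ∞) : WithTop ℕ∞) (ρ ⋆[lsmul ℝ ℝ, (volume : Measure E)] h) ∧
      HasCompactSupport (ρ ⋆[lsmul ℝ ℝ, (volume : Measure E)] h) :=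
  ⟨contDiff_convolution_of_hasCompactSupport hρ.locallyIntegrable hh hhc, hρc.convolution _ hhc⟩

/-- **Slice identity, first order**: `e^{σΔ}(∂_c(ρ ⋆ h))(x) = ∫ heatD1 σ c ρ (y) h(x - y) dy`.
[folklore] -/
theorem heatExtension_fderiv_convolution_eq_integral {σ : ℝ} (hσ : 0 < σ) (c x : E) :
    UnboundedOperators.heatExtension (fun y => fderiv ℝ (ρ ⋆[lsmul ℝ ℝ, (volume : Measure E)] h) y c) σ x =
      ∫ y, heatD1 σ c ρ y * h (x - y) := by
  obtain ⟨hF, hFc⟩ := contDiff_hasCompactSupport_convolution hρ hρc hh hhc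
  obtain ⟨hF₁, hF₁c⟩ := contDiff_hasCompactSupport_fderiv_apply hF hFc c
  have m0 := memLp_one_of_contDiff_hasCompactSupport hF hFc
  have m1 := memLp_one_of_contDiff_hasCompactSupport hF₁ hF₁c
  rw [← UnboundedOperators.fderiv_heatExtension_apply_eq_heatExtension_fderiv
    (hF.of_le (by exact_mod_cast le_top)) m0 le_rfl m1 le_rfl hσ x]
  change heatD1 σ c (ρ ⋆[lsmul ℝ ℝ, (volume : Measure E)] h) x = _
  rw [heatD1_convolution_eq hρ hh.continuous hhc hσ c, convolution_def]
  rfl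

/-- **Slice identity, second order**: `e^{σΔ}(∂ᵥ∂_c(ρ ⋆ h))(x) = ∫ heatD2 σ v c ρ (y) h(x - y) dy`.
[folklore] -/
theorem heatExtension_fderiv_fderiv_convolution_eq_integral {σ : ℝ} (hσ : 0 < σ) (v c x : E) :
    UnboundedOperators.heatExtension
      (fun y => fderiv ℝ (fun y' => fderiv ℝ (ρ ⋆[lsmul ℝ ℝ, (volume : Measure E)] h) y' c) y v) σ x =
      ∫ y, heatD2 σ v c ρ y * h (x - y) := by
  obtain ⟨hF, hFc⟩ := contDiff_hasCompactSupport_convolution hρ hρc hh hhc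
  obtain ⟨hF₁, hF₁c⟩ := contDiff_hasCompactSupport_fderiv_apply hF hFc c
  obtain ⟨hF₂, hF₂c⟩ := contDiff_hasCompactSupport_fderiv_apply hF₁ hF₁c v
  have m0 := memLp_one_of_contDiff_hasCompactSupport hF hFc
  have m1 := memLp_one_of_contDiff_hasCompactSupport hF₁ hF₁c
  have m2 := memLp_one_of_contDiff_hasCompactSupport hF₂ hF₂c
  have hρ1 : MemLp ρ 1 volume := (memLp_one_iff_integrable).2 hρ
  have h2 : 0 < σ / 2 := by positivity
  -- commute the two derivatives with the heat flow
  have step1 : (fun y => fderiv ℝ (UnboundedOperators.heatExtension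
      (ρ ⋆[lsmul ℝ ℝ, (volume : Measure E)] h) σ) y c) =
      UnboundedOperators.heatExtension (fun y' => fderiv ℝ (ρ ⋆[lsmul ℝ ℝ, (volume : Measure E)] h) y' c) σ :=
    funext fun y => UnboundedOperators.fderiv_heatExtension_apply_eq_heatExtension_fderiv
      (hF.of_le (by exact_mod_cast le_top)) m0 le_rfl m1 le_rfl hσ y
  rw [← UnboundedOperators.fderiv_heatExtension_apply_eq_heatExtension_fderiv
    (hF₁.of_le (by exact_mod_cast le_top)) m1 le_rfl m2 le_rfl hσ x, ← step1]
  change heatD2 σ v c (ρ ⋆[lsmul ℝ ℝ, (volume : Measure E)] h) x = _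
  -- `heatD2 σ = heatD1 (σ/2) ∘ heatD1 (σ/2)` on both sides
  rw [show σ = σ / 2 + σ / 2 by ring, heatD2_eq_heatD1_heatD1 m0 le_rfl h2 h2 v c,
    heatD1_convolution_eq hρ hh.continuous hhc h2 c,
    heatD1_convolution_eq ((memLp_one_iff_integrable).1 (memLp_heatD1 hρ1 le_rfl h2 c))
      hh.continuous hhc h2 v,
    ← heatD2_eq_heatD1_heatD1 hρ1 le_rfl h2 h2 v c, convolution_def]
  rfl

/-- **Slice identity, third order**:
`e^{σΔ}(∂ᵤ∂ᵥ∂_c(ρ ⋆ h))(x) = ∫ heatD3 σ u v c ρ (y) h(x - y) dy`. [folklore] -/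
theorem heatExtension_fderiv3_convolution_eq_integral {σ : ℝ} (hσ : 0 < σ) (u v c x : E) :
    UnboundedOperators.heatExtension
      (fun y => fderiv ℝ (fun z => fderiv ℝ (fun y' =>
        fderiv ℝ (ρ ⋆[lsmul ℝ ℝ, (volume : Measure E)] h) y' c) z v) y u) σ x =
      ∫ y, heatD3 σ u v c ρ y * h (x - y) := by
  obtain ⟨hF, hFc⟩ := contDiff_hasCompactSupport_convolution hρ hρc hh hhc
  obtain ⟨hF₁, hF₁c⟩ := contDiff_hasCompactSupport_fderiv_apply hF hFc c
  obtain ⟨hF₂, hF₂c⟩ := contDiff_hasCompactSupport_fderiv_apply hF₁ hF₁c v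
  obtain ⟨hF₃, hF₃c⟩ := contDiff_hasCompactSupport_fderiv_apply hF₂ hF₂c u
  have m0 := memLp_one_of_contDiff_hasCompactSupport hF hFc
  have m1 := memLp_one_of_contDiff_hasCompactSupport hF₁ hF₁c
  have m2 := memLp_one_of_contDiff_hasCompactSupport hF₂ hF₂c
  have m3 := memLp_one_of_contDiff_hasCompactSupport hF₃ hF₃c
  have hρ1 : MemLp ρ 1 volume := (memLp_one_iff_integrable).2 hρ
  have h3 : 0 < σ / 3 := by positivity
  have step1 : (fun y => fderiv ℝ (UnboundedOperators.heatExtension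
      (ρ ⋆[lsmul ℝ ℝ, (volume : Measure E)] h) σ) y c) =
      UnboundedOperators.heatExtension (fun y' => fderiv ℝ (ρ ⋆[lsmul ℝ ℝ, (volume : Measure E)] h) y' c) σ :=
    funext fun y => UnboundedOperators.fderiv_heatExtension_apply_eq_heatExtension_fderiv
      (hF.of_le (by exact_mod_cast le_top)) m0 le_rfl m1 le_rfl hσ y
  have step2 : (fun y => fderiv ℝ (UnboundedOperators.heatExtension
      (fun y' => fderiv ℝ (ρ ⋆[lsmul ℝ ℝ, (volume : Measure E)] h) y' c) σ) y v) =
      UnboundedOperators.heatExtension (fun z => fderiv ℝ (fun y' =>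
        fderiv ℝ (ρ ⋆[lsmul ℝ ℝ, (volume : Measure E)] h) y' c) z v) σ :=
    funext fun y => UnboundedOperators.fderiv_heatExtension_apply_eq_heatExtension_fderiv
      (hF₁.of_le (by exact_mod_cast le_top)) m1 le_rfl m2 le_rfl hσ y
  rw [← UnboundedOperators.fderiv_heatExtension_apply_eq_heatExtension_fderiv
    (hF₂.of_le (by exact_mod_cast le_top)) m2 le_rfl m3 le_rfl hσ x, ← step2, ← step1]
  change heatD3 σ u v c (ρ ⋆[lsmul ℝ ℝ, (volume : Measure E)] h) x = _
  have i1 : Integrable (heatD1 (σ / 3) c ρ) volume :=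
    (memLp_one_iff_integrable).1 (memLp_heatD1 hρ1 le_rfl h3 c)
  have i2 : Integrable (heatD1 (σ / 3) v (heatD1 (σ / 3) c ρ)) volume :=
    (memLp_one_iff_integrable).1 (memLp_heatD1 (memLp_heatD1 hρ1 le_rfl h3 c) le_rfl h3 v)
  rw [show σ = σ / 3 + σ / 3 + σ / 3 by ring, heatD3_eq_heatD1_heatD1_heatD1 m0 le_rfl h3 h3 h3 u v c,
    heatD1_convolution_eq hρ hh.continuous hhc h3 c,
    heatD1_convolution_eq i1 hh.continuous hhc h3 v,
    heatD1_convolution_eq i2 hh.continuous hhc h3 u,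
    ← heatD3_eq_heatD1_heatD1_heatD1 hρ1 le_rfl h3 h3 h3 u v c, convolution_def]
  rfl

end Slice

/-! ### The backward heat equation for `η = 𝒰[g]` -/

/-- **`∂ₛη + Δη = -g`** for `η = heatDuhamelBack 1 g`, `g` a space–time test function (the tree's
`heatDuhamelBack_backward_heat`, `deriv_heatDuhamelBack_time`, `laplacian_heatDuhamelBack`).
[folklore] -/
theorem timeDeriv_add_laplacian_heatDuhamelBack_one {g : ℝ → E → ℝ}
    (hg : IsSpaceTimeTestOn (⊤ : Opens (ℝ × E)) g) (s : ℝ) (x : E) :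
    timeDeriv (heatDuhamelBack 1 g) s x + (Δ (heatDuhamelBack 1 g s)) x = -g s x := by
  rw [timeDeriv_apply, hg.deriv_heatDuhamelBack_time one_pos s x,
    hg.laplacian_heatDuhamelBack one_pos s x]
  have h := hg.heatDuhamelBack_backward_heat one_pos s x
  rwa [one_smul] at h

/-- `𝒰` is additive on space–time test fields (pointwise). [folklore] -/
theorem heatDuhamelBack_sub {Θ₁ Θ₂ : ℝ → E → ℝ} (h₁ : IsSpaceTimeTestOn (⊤ : Opens (ℝ × E)) Θ₁)
    (h₂ : IsSpaceTimeTestOn (⊤ : Opens (ℝ × E)) Θ₂) {ν : ℝ} (hν : 0 < ν) (s : ℝ) (x : E) :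
    heatDuhamelBack ν (fun t y => Θ₁ t y - Θ₂ t y) s x =
      heatDuhamelBack ν Θ₁ s x - heatDuhamelBack ν Θ₂ s x := by
  rw [heatDuhamelBack_apply, heatDuhamelBack_apply, heatDuhamelBack_apply,
    ← integral_sub (h₁.integrableOn_duhamelIntegrand hν s x) (h₂.integrableOn_duhamelIntegrand hν s x)]
  refine setIntegral_congr_fun measurableSet_Ioi fun σ _ => ?_
  -- the caloric extension is additive on bounded continuous (here test) data
  rw [UnboundedOperators.heatExtension_apply, UnboundedOperators.heatExtension_apply,
    UnboundedOperators.heatExtension_apply, ← integral_sub]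
  · refine integral_congr_ae (Eventually.of_forall fun y => ?_)
    simp only [smul_eq_mul, mul_sub]
  · exact UnboundedOperators.integrable_heatKernel_smul_comp_sub
      (h₁.contDiff_slice (s + σ)).continuous (h₁.hasCompactSupport_slice (s + σ)) (ν * σ) x
  · exact UnboundedOperators.integrable_heatKernel_smul_comp_sub
      (h₂.contDiff_slice (s + σ)).continuous (h₂.hasCompactSupport_slice (s + σ)) (ν * σ) x

end General

/-! ### The Newtonian families: `Ξ = 𝒰[∂_c N[g]]` and its derivatives (dimension three) -/

section Newton

variable {r₀ r₁ : ℝ} {g : ℝ → (EuclideanSpace ℝ (Fin 3)) → ℝ}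

/-- A space–time test function vanishes outside a large ball in space, uniformly in time.
[folklore] -/
theorem IsSpaceTimeTestOn.exists_forall_eq_zero_of_lt_norm' {E : Type*} [NormedAddCommGroup E]
    [NormedSpace ℝ E] {F : Type*} [NormedAddCommGroup F] [NormedSpace ℝ F] {ψ : ℝ → E → F}
    (hψ : IsSpaceTimeTestOn (⊤ : Opens (ℝ × E)) ψ) :
    ∃ R : ℝ, 0 ≤ R ∧ ∀ t z, R < ‖z‖ → ψ t z = 0 := by
  obtain ⟨K, hK, hsub⟩ := hψ.exists_compact_slice_subset
  obtain ⟨R, hR⟩ := hK.isBounded.subset_closedBall (0 : E)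
  refine ⟨max R 0, le_max_right _ _, fun t z hz => ?_⟩
  apply image_eq_zero_of_notMem_tsupport
  intro h
  have h1 := hR (hsub t h)
  rw [mem_closedBall_zero_iff] at h1
  exact absurd (h1.trans (le_max_left R 0)) (not_le.2 hz)

/-- **`(t, x) ↦ N[g(t, ·)](x)` is a space–time test function on `ℝ × (EuclideanSpace ℝ (Fin 3))`** for a space–time test
function `g` and `0 < r₀ < r₁` (joint smoothness: the tree's
`contDiff_uncurry_newtonNearPotential_slice`; the support grows by `r₁` in space). [folklore] -/
theorem isSpaceTimeTestOn_newtonNearPotential_top (hg : IsSpaceTimeTestOn (⊤ : Opens (ℝ × (EuclideanSpace ℝ (Fin 3)))) g)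
    (h₀ : 0 < r₀) (h₁ : r₀ < r₁) :
    IsSpaceTimeTestOn (⊤ : Opens (ℝ × (EuclideanSpace ℝ (Fin 3)))) (fun t => newtonNearPotential r₀ r₁ (g t)) := by
  refine ⟨contDiff_uncurry_newtonNearPotential_slice hg h₀.le h₁, ?_, fun _ _ => trivial⟩
  -- compact support: time support of `g` times a large closed ball
  obtain ⟨a, b, hab⟩ := hg.exists_time_support
  obtain ⟨R, hR0, hR⟩ := hg.exists_forall_eq_zero_of_lt_norm'
  refine HasCompactSupport.intro ((isCompact_Icc (a := a) (b := b)).prod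
    (isCompact_closedBall (0 : (EuclideanSpace ℝ (Fin 3))) (R + r₁))) ?_
  rintro ⟨t, x⟩ hq
  simp only [uncurry]
  rcases not_and_or.1 (fun h => hq (mem_prod.2 h)) with ht | hx
  · have : g t = 0 := hab t ht
    rw [this]
    exact newtonNearPotential_eq_zero_of_forall h₀.le h₁ (fun z _ => rfl)
  · refine newtonNearPotential_eq_zero_of_forall h₀.le h₁ (fun z hz => hR t _ ?_)
    rw [mem_closedBall_zero_iff, not_le] at hx
    have := norm_sub_norm_le x z
    linarith

/-- The same for the smoothing remainder `(t, x) ↦ Λ[g(t, ·)](x)`. [folklore] -/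
theorem isSpaceTimeTestOn_newtonFarSmoothing_top (hg : IsSpaceTimeTestOn (⊤ : Opens (ℝ × (EuclideanSpace ℝ (Fin 3)))) g)
    (h₀ : 0 < r₀) (h₁ : r₀ < r₁) :
    IsSpaceTimeTestOn (⊤ : Opens (ℝ × (EuclideanSpace ℝ (Fin 3)))) (fun t => newtonFarSmoothing r₀ r₁ (g t)) := by
  refine ⟨contDiff_uncurry_newtonFarSmoothing_slice hg h₀ h₁, ?_, fun _ _ => trivial⟩
  obtain ⟨a, b, hab⟩ := hg.exists_time_support
  obtain ⟨R, hR0, hR⟩ := hg.exists_forall_eq_zero_of_lt_norm'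
  refine HasCompactSupport.intro ((isCompact_Icc (a := a) (b := b)).prod
    (isCompact_closedBall (0 : (EuclideanSpace ℝ (Fin 3))) (R + r₁))) ?_
  rintro ⟨t, x⟩ hq
  simp only [uncurry]
  rcases not_and_or.1 (fun h => hq (mem_prod.2 h)) with ht | hx
  · have : g t = 0 := hab t ht
    rw [this]
    exact newtonFarSmoothing_eq_zero_of_forall h₀.le h₁ (fun z _ => rfl)
  · refine newtonFarSmoothing_eq_zero_of_forall h₀.le h₁ (fun z hz => hR t _ ?_)
    rw [mem_closedBall_zero_iff, not_le] at hx
    have := norm_sub_norm_le x z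
    linarith

variable (hg : IsSpaceTimeTestOn (⊤ : Opens (ℝ × (EuclideanSpace ℝ (Fin 3)))) g) (h₀ : 0 < r₀) (h₁ : r₀ < r₁)
include hg h₀ h₁

/-- The field `(t, x) ↦ ∂_c N[g(t, ·)](x)` is a space–time test function. [folklore] -/
theorem isSpaceTimeTestOn_fderiv_newtonNearPotential_top (c : (EuclideanSpace ℝ (Fin 3))) :
    IsSpaceTimeTestOn (⊤ : Opens (ℝ × (EuclideanSpace ℝ (Fin 3))))
      (fun t x => fderiv ℝ (newtonNearPotential r₀ r₁ (g t)) x c) :=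
  (isSpaceTimeTestOn_newtonNearPotential_top hg h₀ h₁).fderiv_apply_top c

/-- **`Ξ = 𝒰[∂_c N[g]]` is the potential of `g` against `backKernel (heatD1 · c Γ₀)`**, at every
point. [folklore] -/
theorem heatDuhamelBack_fderiv_newtonNearPotential_eq_convolution (c : (EuclideanSpace ℝ (Fin 3))) (s : ℝ) (x : (EuclideanSpace ℝ (Fin 3))) :
    heatDuhamelBack 1 (fun t y => fderiv ℝ (newtonNearPotential r₀ r₁ (g t)) y c) s x =
      (backKernel (fun a y => heatD1 a c (newtonNear r₀ r₁) y) ⋆[lsmul ℝ ℝ, (volume : Measure (ℝ × (EuclideanSpace ℝ (Fin 3))))]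
        uncurry g) (s, x) := by
  refine heatDuhamelBack_one_eq_convolution_backKernel s x (fun σ hσ => ?_)
    ((isSliceBoundKernel_backKernel_heatD1_newtonNear h₀ h₁ c).integrable_backKernel_mul_test hg s x)
  rw [newtonNearPotential_eq_convolution]
  exact heatExtension_fderiv_convolution_eq_integral (integrable_newtonNear h₀.le h₁)
    (hasCompactSupport_newtonNear h₀.le h₁) (hg.contDiff_slice (s + σ))
    (hg.hasCompactSupport_slice (s + σ)) hσ c x

/-- **`∂ᵥΞ` is the potential of `g` against `backKernel (heatD2 · v c Γ₀)` off the diagonal**: the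
identity holds at every `(s, x)` with `δ ≤ ‖x - y‖` for all `y` in the spatial support of `g`.
[folklore] -/
theorem fderiv_heatDuhamelBack_fderiv_newtonNearPotential_eq_convolution (v c : (EuclideanSpace ℝ (Fin 3))) {δ : ℝ}
    (hδ : 0 < δ) {A : Set (EuclideanSpace ℝ (Fin 3))} (hA : ∀ t y, g t y ≠ 0 → y ∈ A) (s : ℝ) (x : (EuclideanSpace ℝ (Fin 3)))
    (hx : ∀ a ∈ A, δ ≤ ‖x - a‖) :
    fderiv ℝ (heatDuhamelBack 1 (fun t y => fderiv ℝ (newtonNearPotential r₀ r₁ (g t)) y c) s) x v =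
      (backKernel (fun a y => heatD2 a v c (newtonNear r₀ r₁) y) ⋆[lsmul ℝ ℝ, (volume : Measure (ℝ × (EuclideanSpace ℝ (Fin 3))))]
        uncurry g) (s, x) := by
  have hΘ := isSpaceTimeTestOn_fderiv_newtonNearPotential_top hg h₀ h₁ c
  rw [hΘ.fderiv_heatDuhamelBack_apply one_pos s x v]
  refine heatDuhamelBack_one_eq_convolution_backKernel s x (fun σ hσ => ?_)
    ((isOffDiagKernel_backKernel_heatD2_newtonNear h₀ h₁ hδ v c).integrable_backKernel_mul_test hg hA
      s x (fun a ha => hx a ha))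
  simp only [newtonNearPotential_eq_convolution]
  exact heatExtension_fderiv_fderiv_convolution_eq_integral (integrable_newtonNear h₀.le h₁)
    (hasCompactSupport_newtonNear h₀.le h₁) (hg.contDiff_slice (s + σ))
    (hg.hasCompactSupport_slice (s + σ)) hσ v c x

/-- **`∂ᵤ∂ᵥΞ` is the potential of `g` against `backKernel (heatD3 · u v c Γ₀)`** at every point,
for `‖u‖, ‖v‖, ‖c‖ ≤ 1`. [folklore] -/
theorem fderiv_fderiv_heatDuhamelBack_fderiv_newtonNearPotential_eq_convolution {u v c : (EuclideanSpace ℝ (Fin 3))}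
    (hu : ‖u‖ ≤ 1) (hv : ‖v‖ ≤ 1) (hc : ‖c‖ ≤ 1) (s : ℝ) (x : (EuclideanSpace ℝ (Fin 3))) :
    fderiv ℝ (fun x' => fderiv ℝ
      (heatDuhamelBack 1 (fun t y => fderiv ℝ (newtonNearPotential r₀ r₁ (g t)) y c) s) x' v) x u =
      (backKernel (fun a y => heatD3 a u v c (newtonNear r₀ r₁) y) ⋆[lsmul ℝ ℝ, (volume : Measure (ℝ × (EuclideanSpace ℝ (Fin 3))))]
        uncurry g) (s, x) := by
  have hΘ := isSpaceTimeTestOn_fderiv_newtonNearPotential_top hg h₀ h₁ c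
  have hΘv := hΘ.fderiv_apply_top v
  have step1 : (fun x' => fderiv ℝ
      (heatDuhamelBack 1 (fun t y => fderiv ℝ (newtonNearPotential r₀ r₁ (g t)) y c) s) x' v) =
      heatDuhamelBack 1 (fun t y => fderiv ℝ (fun y' => fderiv ℝ (newtonNearPotential r₀ r₁ (g t)) y' c) y v) s :=
    funext fun x' => hΘ.fderiv_heatDuhamelBack_apply one_pos s x' v
  rw [step1, hΘv.fderiv_heatDuhamelBack_apply one_pos s x u]
  obtain ⟨C, hC, hK⟩ := exists_isSliceBoundKernel_backKernel_heatD3_newtonNear h₀ h₁ hu hv hc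
  refine heatDuhamelBack_one_eq_convolution_backKernel s x (fun σ hσ => ?_)
    (hK.integrable_backKernel_mul_test hg s x)
  simp only [newtonNearPotential_eq_convolution]
  exact heatExtension_fderiv3_convolution_eq_integral (integrable_newtonNear h₀.le h₁)
    (hasCompactSupport_newtonNear h₀.le h₁) (hg.contDiff_slice (s + σ))
    (hg.hasCompactSupport_slice (s + σ)) hσ u v c x

/-- **`𝒰[Λ[∂_c g]]` is the potential of `g` against `backKernel (heatD1 · c λ)`** at every point.
[folklore] -/
theorem heatDuhamelBack_newtonFarSmoothing_fderiv_eq_convolution (c : (EuclideanSpace ℝ (Fin 3))) (s : ℝ) (x : (EuclideanSpace ℝ (Fin 3))) :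
    heatDuhamelBack 1 (fun t y => newtonFarSmoothing r₀ r₁ (fun y' => fderiv ℝ (g t) y' c) y) s x =
      (backKernel (fun a y => heatD1 a c (newtonFarLaplacian r₀ r₁) y) ⋆[lsmul ℝ ℝ, (volume : Measure (ℝ × (EuclideanSpace ℝ (Fin 3))))]
        uncurry g) (s, x) := by
  refine heatDuhamelBack_one_eq_convolution_backKernel s x (fun σ hσ => ?_)
    ((isOffDiagKernel_backKernel_heatD1_newtonFarLaplacian h₀ h₁ c).integrable_backKernel_mul_test hg
      (A := univ) (fun _ _ _ => mem_univ _) s x (fun _ _ => mem_univ _))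
  -- `Λ[∂_c h] = ∂_c Λ[h] = ∂_c (λ ⋆ h)`
  have h1 : (fun y => newtonFarSmoothing r₀ r₁ (fun y' => fderiv ℝ (g (s + σ)) y' c) y) =
      fun y => fderiv ℝ (newtonFarLaplacian r₀ r₁ ⋆[lsmul ℝ ℝ, (volume : Measure (EuclideanSpace ℝ (Fin 3)))] g (s + σ)) y c := by
    funext y
    rw [← newtonFarSmoothing_eq_convolution,
      fderiv_newtonFarSmoothing_apply h₀ h₁ ((hg.contDiff_slice (s + σ)).of_le (by exact_mod_cast le_top))]
  rw [h1]
  exact heatExtension_fderiv_convolution_eq_integral (integrable_newtonFarLaplacian h₀ h₁)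
    (hasCompactSupport_newtonFarLaplacian h₀.le h₁) (hg.contDiff_slice (s + σ))
    (hg.hasCompactSupport_slice (s + σ)) hσ c x

/-- **The Laplacian of `Ξ`**: `ΔΞ(s, ·)(x) = ∂_cη(s, x) - 𝒰[Λ[∂_c g]](s, x)` with `η = 𝒰[g]`
(`Δ` through `𝒰`, `∂_c N[h] = N[∂_c h]`, and `ΔN[h] = h - Λ[h]`). [folklore] -/
theorem laplacian_heatDuhamelBack_fderiv_newtonNearPotential (c : (EuclideanSpace ℝ (Fin 3))) (s : ℝ) (x : (EuclideanSpace ℝ (Fin 3))) :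
    (Δ (heatDuhamelBack 1 (fun t y => fderiv ℝ (newtonNearPotential r₀ r₁ (g t)) y c) s)) x =
      fderiv ℝ (heatDuhamelBack 1 g s) x c -
        heatDuhamelBack 1 (fun t y => newtonFarSmoothing r₀ r₁ (fun y' => fderiv ℝ (g t) y' c) y) s x := by
  have hΘ := isSpaceTimeTestOn_fderiv_newtonNearPotential_top hg h₀ h₁ c
  have hgc : IsSpaceTimeTestOn (⊤ : Opens (ℝ × (EuclideanSpace ℝ (Fin 3)))) (fun t y => fderiv ℝ (g t) y c) := hg.fderiv_apply_top c
  have hΛ := isSpaceTimeTestOn_newtonFarSmoothing_top hgc h₀ h₁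
  rw [hΘ.laplacian_heatDuhamelBack one_pos s x, hg.fderiv_heatDuhamelBack_apply one_pos s x c,
    ← heatDuhamelBack_sub hgc hΛ one_pos s x]
  congr 1
  funext t y
  -- `Δ (∂_c N[g t]) = Δ N[∂_c g t] = ∂_c g t - Λ[∂_c g t]`
  have h1 : (fun y' => fderiv ℝ (newtonNearPotential r₀ r₁ (g t)) y' c) =
      newtonNearPotential r₀ r₁ (fun w => fderiv ℝ (g t) w c) :=
    funext fun y' => fderiv_newtonNearPotential_apply h₀.le h₁
      ((hg.contDiff_slice t).of_le (by exact_mod_cast le_top)) y' c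
  have h2 : ContDiff ℝ 2 (fun w => fderiv ℝ (g t) w c) :=
    (hgc.contDiff_slice t).of_le (by
      change ((2 : ℕ∞) : WithTop ℕ∞) ≤ ((⊤ : ℕ∞) : WithTop ℕ∞); exact_mod_cast le_top)
  rw [h1, laplacian_newtonNearPotential h₀ h₁ h2]

end Newton

end Literature.Analysis.FluidPDE
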